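import Summits.HodgeConjecture.HodgeCM.Model.ThetaAdelicSideGuardedT2Ops_1

/-! PORT of `HodgeCM/Model/ThetaAdelicSideGuardedT2Ops.lean` (HodgeCMPerL run 82) — part 2: continuation of `Summits.HodgeConjecture.HodgeCM.Model.ThetaAdelicSideGuardedT2Ops_1` (split at a top-level declaration boundary by port_pkg.py; scope re-opened below; declarations unchanged). -/

-- port_pkg: scope re-opened for this part (file-level context, then the namespace/section stack open at the cut)
set_option autoImplicit false
noncomputable section
open scoped Matrix SchwartzMap
open NumberField NumberField.mixedEmbedding
open Literature.NumberTheory.Automorphic Literature.NumberTheory.Weil1964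
open Literature.NumberTheory.GelbartRogawski1991.UnitaryDualPair
open HodgeCM.Adelic HodgeCM.PerL34
open Literature.Geometry.ComplexHyperbolic.BallModel (U21)
namespace HodgeCM.Model
namespace SInstance
open HodgeCM.Model.ArchSideTerm
section PinR2J
variable
  (hGR : ∀ {L : CMField} {ι₁ : L →+* ℂ} (V : HermSpace3 L ι₁) (c : SeesawCtx L),
    (cmSplittingDatum (L : Type) finProdFinEquiv (frameD V) (frameD_real V) (frameD_ne V) (dW c.D) (dW_real c.D)
      (dW_ne c.D)).CompatibleSplitting)
  (hGR₀ : ∀ {L : CMField} {ι₁ : L →+* ℂ} (V : HermSpace3 L ι₁) (c : SeesawCtx L),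
    (cmSplittingDatum (L : Type) (e₁) (frameD V) (frameD_real V) (frameD_ne V) (lineVec (L : Type) (dW c.D 0))
      (fun _ => dW_real c.D 0) (fun _ => dW_ne c.D 0)).CompatibleSplitting)
  (hGR₁ : ∀ {L : CMField} {ι₁ : L →+* ℂ} (V : HermSpace3 L ι₁) (c : SeesawCtx L),
    (cmSplittingDatum (L : Type) (e₁) (frameD V) (frameD_real V) (frameD_ne V) (lineVec (L : Type) (dW c.D 1))
      (fun _ => dW_real c.D 1) (fun _ => dW_ne c.D 1)).CompatibleSplitting)
  (hGR₂ : ∀ {L : CMField} {ι₁ : L →+* ℂ} (V : HermSpace3 L ι₁) (c : SeesawCtx L),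
    (cmSplittingDatum (L : Type) (e₁) (frameD V) (frameD_real V) (frameD_ne V) (lineVec (L : Type) (dW' c.D 0))
      (fun _ => dW'_real c.D 0) (fun _ => dW'_ne c.D 0)).CompatibleSplitting)
  (hGR₃ : ∀ {L : CMField} {ι₁ : L →+* ℂ} (V : HermSpace3 L ι₁) (c : SeesawCtx L),
    (cmSplittingDatum (L : Type) (e₁) (frameD V) (frameD_real V) (frameD_ne V) (lineVec (L : Type) (dW' c.D 1))
      (fun _ => dW'_real c.D 1) (fun _ => dW'_ne c.D 1)).CompatibleSplitting)
  (μ : ∀ {L : CMField}, SeesawCtx L → Fin 4 → NumberField.InfinitePlace (L : Type) → ℤ)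
variable {L : CMField} {ι₁ : L →+* ℂ} (V : HermSpace3 L ι₁) (c : SeesawCtx L)
/-- `(P k).ΓU` of pin R2 with no PROVE input (both branches). -/
theorem SROGT'CJ_P_ΓU (k : Fin 4) :
    ((SROGT'CJ @hGR @hGR₀ @hGR₁ @hGR₂ @hGR₃ @μ V c).P k).ΓU = (V.latticeModel printFact_unitaryCompact_holds).Γ :=
  (SROGT'CJ @hGR @hGR₀ @hGR₁ @hGR₂ @hGR₃ @μ V c).hΓU k

/-- under the OG guard `(SROGT'CJ … V c).ιinf = archInfOf V`. -/
theorem SROGT'CJ_ιinf (hc : GOG V c) : (SROGT'CJ @hGR @hGR₀ @hGR₁ @hGR₂ @hGR₃ @μ V c).ιinf = archInfOf V :=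
  SROGT'C_ιinf @hGR @hGR₀ @hGR₁ @hGR₂ @hGR₃ (ArchSideTerm.muSharp₂₃ @μ) _ _ _ V c hc

/-- under the OG guard `(SROGT'CJ … V c).Gfin = archFinOf V`. -/
theorem SROGT'CJ_Gfin (hc : GOG V c) : (SROGT'CJ @hGR @hGR₀ @hGR₁ @hGR₂ @hGR₃ @μ V c).Gfin = archFinOf V :=
  SROGT'C_Gfin @hGR @hGR₀ @hGR₁ @hGR₂ @hGR₃ (ArchSideTerm.muSharp₂₃ @μ) _ _ _ V c hc

/-- D-1′'s frame junction `hι` at pin R2 with no PROVE input, under the OG guard. -/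
theorem SROGT'CJ_ιinf_apply (hc : GOG V c) (hV : IsAnisotropic L V.Hm) (u : U21) :
    (SROGT'CJ @hGR @hGR₀ @hGR₁ @hGR₂ @hGR₃ @μ V c).ιinf u =
      Adelic.regimeEquiv L V.Hm hV
        (UnitaryGroup.archSectionU21CM (L : Type) ι₁ V.Hm V.sylvesterFrame (sylvesterFrame_J V) u) :=
  SROGT'C_ιinf_apply @hGR @hGR₀ @hGR₁ @hGR₂ @hGR₃ (ArchSideTerm.muSharp₂₃ @μ) _ _ _ V c hc hV u

/-- (L3b) at pin R2 with no PROVE input, under the OG guard. -/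
theorem regimeEquiv_prodSymm_one_mem_SROGT'CJ_Gfin (hc : GOG V c) (hV : IsAnisotropic L V.Hm)
    (kf : ↥(UnitaryGroup.finAdelic (↥(maximalRealSubfield L)) (L : Type) (IsCMField.complexConj L) 3 V.Hm)) :
    (Adelic.regimeEquiv L V.Hm hV ((UnitaryGroup.cmAdelicProdEquiv (L : Type) 3 V.Hm).symm (1, kf)) :
        (V.latticeModel printFact_unitaryCompact_holds).G) ∈
      (SROGT'CJ @hGR @hGR₀ @hGR₁ @hGR₂ @hGR₃ @μ V c).Gfin :=
  regimeEquiv_prodSymm_one_mem_SROGT'C_Gfin @hGR @hGR₀ @hGR₁ @hGR₂ @hGR₃ (ArchSideTerm.muSharp₂₃ @μ) _ _ _ V c hc hV kf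

/-- **the weight facts at pin R2 with no PROVE input**: `((SROGT'CJ … V c).P k).w = archWeight L (μ♯♯ c k)`, `μ♯♯ := muSharp₂₃ μ`. -/
theorem SROGT'CJ_P_w (hc : GOG V c) (k : Fin 4) :
    ((SROGT'CJ @hGR @hGR₀ @hGR₁ @hGR₂ @hGR₃ @μ V c).P k).w = ⇑(Literature.NumberTheory.Automorphic.archWeight (L : Type) (ArchSideTerm.muSharp₂₃ @μ c k)) :=
  SROGT'C_P_w @hGR @hGR₀ @hGR₁ @hGR₂ @hGR₃ (ArchSideTerm.muSharp₂₃ @μ) _ _ _ V c hc k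

/-- binder-1's **`op`** at pin R2 with no PROVE input, under the OG guard (`η` at the W-character `χWR μ♯♯`). -/
theorem op_SROGT'CJ (hc : GOG V c)
    (g : ↥(regimeSubgroup L V.Hm)) (t : NumberField.SeesawTorus (↥(maximalRealSubfield L)) L)
    (φ₁ φ₂ : piSchwartzBruhat (↥(maximalRealSubfield L)) (Fin 3)) :
    cmPairRepTwist (L : Type) finProdFinEquiv (frameD V) (frameD_real V) (frameD_ne V) (dW c.D) (dW_real c.D) (dW_ne c.D) (hGR V c)
        (EtaChi.η (@χVR @hGR @hGR₀ @hGR₁) (@χWR @hGR @hGR₀ @hGR₁ (ArchSideTerm.muSharp₂₃ @μ)) V c)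
        ((cmFrameEquiv (L : Type) (frameG V) V.Hm (frameD V) (frame_congr V)) (g : ↥(HodgeCM.Adelic.adelicUnitaryGroup (L : Type) V.Hm)),
          cmAdelicEquiv (L : Type) 2 (Matrix.diagonal (dW c.D)) (c.D.jT₁₂ t)) (tau12 V c.D φ₁ φ₂) =
      tau12 V c.D (((SROGT'CJ @hGR @hGR₀ @hGR₁ @hGR₂ @hGR₃ @μ V c).P 0).ω (g, NumberField.SeesawTorus.fst _ L t) φ₁)
        (((SROGT'CJ @hGR @hGR₀ @hGR₁ @hGR₂ @hGR₃ @μ V c).P 1).ω (g, NumberField.SeesawTorus.snd _ L t) φ₂) :=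
  op_SROGT'C @hGR @hGR₀ @hGR₁ @hGR₂ @hGR₃ (ArchSideTerm.muSharp₂₃ @μ) _ _ _ V c hc g t φ₁ φ₂

/-- binder-1's **`seesaw`** at pin R2 with no PROVE input, under the OG guard. -/
theorem seesaw34_SROGT'CJ (hc : GOG V c)
    (g : ↥(regimeSubgroup L V.Hm)) (t : NumberField.SeesawTorus (↥(maximalRealSubfield L)) L)
    (φ₂ φ₃ : piSchwartzBruhat (↥(maximalRealSubfield L)) (Fin 3)) :
    thetaDistLM (↥(maximalRealSubfield L)) (Fin 6)
        (cmPairRepTwist (L : Type) finProdFinEquiv (frameD V) (frameD_real V) (frameD_ne V) (dW c.D) (dW_real c.D) (dW_ne c.D) (hGR V c)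
          (EtaChi.η (@χVR @hGR @hGR₀ @hGR₁) (@χWR @hGR @hGR₀ @hGR₁ (ArchSideTerm.muSharp₂₃ @μ)) V c)
          ((cmFrameEquiv (L : Type) (frameG V) V.Hm (frameD V) (frame_congr V)) (g : ↥(HodgeCM.Adelic.adelicUnitaryGroup (L : Type) V.Hm)),
            cmAdelicEquiv (L : Type) 2 (Matrix.diagonal (dW c.D)) (c.D.jT₃₄ t)) (tau34 V c.D φ₂ φ₃)) =
      thetaDistLM (↥(maximalRealSubfield L)) (Fin 3)
          ((((SROGT'CJ @hGR @hGR₀ @hGR₁ @hGR₂ @hGR₃ @μ V c).P 2).ω (g, NumberField.SeesawTorus.fst _ L t) φ₂)) *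
        thetaDistLM (↥(maximalRealSubfield L)) (Fin 3)
          ((((SROGT'CJ @hGR @hGR₀ @hGR₁ @hGR₂ @hGR₃ @μ V c).P 3).ω (g, NumberField.SeesawTorus.snd _ L t) φ₃)) :=
  seesaw34_SROGT'C @hGR @hGR₀ @hGR₁ @hGR₂ @hGR₃ (ArchSideTerm.muSharp₂₃ @μ) _ _ _ V c hc g t φ₂ φ₃

/-- the operator-level (34) identity at pin R2 with no PROVE input, under the OG guard. -/
theorem op34_SROGT'CJ (hc : GOG V c)
    (g : ↥(regimeSubgroup L V.Hm)) (t : NumberField.SeesawTorus (↥(maximalRealSubfield L)) L)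
    (φ₂ φ₃ : piSchwartzBruhat (↥(maximalRealSubfield L)) (Fin 3)) :
    cmPairRepTwist (L : Type) finProdFinEquiv (frameD V) (frameD_real V) (frameD_ne V) (dW c.D) (dW_real c.D) (dW_ne c.D) (hGR V c)
        (EtaChi.η (@χVR @hGR @hGR₀ @hGR₁) (@χWR @hGR @hGR₀ @hGR₁ (ArchSideTerm.muSharp₂₃ @μ)) V c)
        ((cmFrameEquiv (L : Type) (frameG V) V.Hm (frameD V) (frame_congr V)) (g : ↥(HodgeCM.Adelic.adelicUnitaryGroup (L : Type) V.Hm)),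
          cmAdelicEquiv (L : Type) 2 (Matrix.diagonal (dW c.D)) (c.D.jT₃₄ t)) (tau34 V c.D φ₂ φ₃) =
      tau34 V c.D (((SROGT'CJ @hGR @hGR₀ @hGR₁ @hGR₂ @hGR₃ @μ V c).P 2).ω (g, NumberField.SeesawTorus.fst _ L t) φ₂)
        (((SROGT'CJ @hGR @hGR₀ @hGR₁ @hGR₂ @hGR₃ @μ V c).P 3).ω (g, NumberField.SeesawTorus.snd _ L t) φ₃) :=
  op34_SROGT'C @hGR @hGR₀ @hGR₁ @hGR₂ @hGR₃ (ArchSideTerm.muSharp₂₃ @μ) _ _ _ V c hc g t φ₂ φ₃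

end PinR2J

end SInstance

end HodgeCM.Model

end
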